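import Mathlib
import Literature.Combinatorics.Optimization.UdisjShiftNonnegativeRank
import HarnessLib

/-!
# Braun–Fiorini–Pokutta–Steurer 2012, §4.3: polyhedral inapproximability of SDPs (Lemma 9, Theorem 10) — PROVED

G. Braun, S. Fiorini, S. Pokutta, D. Steurer, *Approximation Limits of Linear Programs (Beyond Hierarchies)*,
FOCS 2012 = arXiv:1204.0957 [BraunEtAl2012] (journal: Math. Oper. Res. 40 (2015) [BraunEtAl2015]), §4.3
(pp. 14–15, materialised `paper:arxiv-1204.0957` p0014–p0015): «there exists a spectrahedron with small
semidefinite extension complexity but high approximate extension complexity».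

* `udisjLeftVec a = (1, −a)`, `udisjRightVec b = (1, b)` in `ℝ^{n+1}`, and the rank-one psd matrices
  `T_a = (1,−a)(1,−a)ᵀ`, `U^b = (1,b)(1,b)ᵀ` with `⟨T_a, U^b⟩ = (1 − aᵀb)²` (the psd factorisation (3.1) of
  UDISJ of size `n + 1`, p. 8 / p. 14).
* `bfpsSpectrahedron n` — the spectrahedron `S ⊆ ℝ^{n×n}` of **Lemma 9**, GIVEN BY ITS SEMIDEFINITE EF OF
  SIZE `n + 1` (4.3): `S = {x ∣ ∃ Y ∈ S^{n+1}_+, ⟨2diag(a) − aaᵀ, x⟩ + ⟨T_a, Y⟩ = 1 ∀ a ∈ {0,1}ⁿ}`; so the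
  printed `xc_SDP(S) ≤ n + 1` is the definition itself (the paper's «size of a semidefinite EF» is the order
  of the psd variable `Y`, p. 14).
* `corPolytope_subset_bfpsSpectrahedron`, `bfpsSpectrahedron_subset_corOuter` — **Lemma 9**: `COR(n) ⊆ S ⊆ Q(n)`.
* `l1Nbhd S δ` — the closed `δ`-neighbourhood in the entrywise `ℓ₁`-norm; `l1Nbhd_bfpsSpectrahedron_subset`
  — «`S^{ρ−1} ⊆ ρQ`» (p. 15, `‖2diag(a) − aaᵀ‖_∞ ≤ 1`).
* `BFPS2012_thm10` — **Theorem 10, second bullet**: for `0 ≤ β < 1/2`, `C > 0` there are `c > 0`, `n₀` with: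
  for `n ≥ n₀` and `1 ≤ ρ ≤ C n^β`, every `K` with `S ⊆ K ⊆ S^{ρ−1}` admitting a size-`r` extended
  formulation has `2^{c n^{1−2β}} ≤ r`; `BFPS2012_thm10_fixedRatio` — the first bullet (`ρ` fixed, `2^{Ω(n)}`).
  PROVED from the tree's Theorem 6 (`BFPS2012_corSandwichHard_holds`), exactly as printed.

0 named facts; everything PROVED.  Nothing here is a summit statement; no P-vs-NP / VP-vs-VNP content.
-/

noncomputable section

open Matrix Finset
open scoped Pointwise

namespace Literature.Combinatorics.Optimization

open FixedSizePsdRank (Cube bvec vecOuter flat corPolytope ip udisj)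
open Literature.Barriers.PneNP (HasEFOfSize)

variable {n : ℕ}

/-! ### The size-`(n+1)` psd factorisation of UDISJ -/

/-- `(1, −a) ∈ ℝ^{n+1}`. [cite: BraunEtAl2012, §3 eq. (3.1) / §4.3 proof of Lemma 9 (pp. 8, 14)] -/
def udisjLeftVec (a : Cube n) : Fin (n + 1) → ℝ := Fin.cons 1 (fun i => -bvec a i)

/-- `(1, b) ∈ ℝ^{n+1}`. [cite: BraunEtAl2012, §3 eq. (3.1) / §4.3 proof of Lemma 9 (pp. 8, 14)] -/
def udisjRightVec (b : Cube n) : Fin (n + 1) → ℝ := Fin.cons 1 (bvec b)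

/-- `T_a = (1,−a)(1,−a)ᵀ ∈ S^{n+1}_+`. [cite: BraunEtAl2012, §4.3 proof of Lemma 9 (p. 14)] -/
def udisjLeftMat (a : Cube n) : Matrix (Fin (n + 1)) (Fin (n + 1)) ℝ :=
  vecMulVec (udisjLeftVec a) (udisjLeftVec a)

/-- `U^b = (1,b)(1,b)ᵀ ∈ S^{n+1}_+`. [cite: BraunEtAl2012, §4.3 proof of Lemma 9 (p. 14)] -/
def udisjRightMat (b : Cube n) : Matrix (Fin (n + 1)) (Fin (n + 1)) ℝ :=
  vecMulVec (udisjRightVec b) (udisjRightVec b)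

/-- `aᵀb = Σ_i a_i b_i` for the `0/1` vectors. [cite: BraunEtAl2012, §3.2 (p. 11)] -/
theorem sum_bvec_mul_bvec (a b : Cube n) : ∑ i, bvec a i * bvec b i = ip a b := by
  rw [FixedSizePsdRank.ip_eq_sum]
  push_cast
  refine Finset.sum_congr rfl fun i _ => ?_
  unfold bvec
  by_cases ha : a i = true <;> by_cases hb : b i = true <;> simp [ha, hb]

/-- `(1,−a)·(1,b) = 1 − aᵀb`. [cite: BraunEtAl2012, §3 (p. 8, "`⟨T_a, U^b⟩ = (1 − aᵀb)²`")] -/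
theorem udisjLeftVec_dotProduct_udisjRightVec (a b : Cube n) :
    udisjLeftVec a ⬝ᵥ udisjRightVec b = 1 - ip a b := by
  unfold udisjLeftVec udisjRightVec dotProduct
  rw [Fin.sum_univ_succ]
  simp only [Fin.cons_zero, Fin.cons_succ, mul_one, neg_mul, Finset.sum_neg_distrib]
  rw [sum_bvec_mul_bvec]
  ring

/-- `tr((z zᵀ) Y) = zᵀ Y z`. [cite: BraunEtAl2012, §4.3 proof of Lemma 9 (p. 14, "`⟨T_a, Y⟩ ≥ 0`")] -/
theorem trace_vecMulVec_self_mul (z : Fin (n + 1) → ℝ) (Y : Matrix (Fin (n + 1)) (Fin (n + 1)) ℝ) :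
    (vecMulVec z z * Y).trace = z ⬝ᵥ (Y *ᵥ z) := by
  rw [vecMulVec_mul, trace_vecMulVec, dotProduct_comm, ← dotProduct_mulVec]

/-- `⟨T_a, U^b⟩ = (1 − aᵀb)²`. [cite: BraunEtAl2012, §4.3 proof of Lemma 9 (p. 14)] -/
theorem trace_udisjLeftMat_mul_udisjRightMat (a b : Cube n) :
    (udisjLeftMat a * udisjRightMat b).trace = udisj n a b := by
  unfold udisjLeftMat udisjRightMat udisj
  rw [vecMulVec_mul_vecMulVec, trace_vecMulVec, dotProduct_smul, smul_eq_mul,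
    udisjLeftVec_dotProduct_udisjRightVec]
  ring

/-- `T_a ⪰ 0`. [cite: BraunEtAl2012, §4.3 proof of Lemma 9 (p. 14)] -/
theorem posSemidef_udisjLeftMat (a : Cube n) : (udisjLeftMat a).PosSemidef := by
  unfold udisjLeftMat
  simpa using Matrix.posSemidef_vecMulVec_self_star (udisjLeftVec a)

/-- `U^b ⪰ 0`. [cite: BraunEtAl2012, §4.3 proof of Lemma 9 (p. 14)] -/
theorem posSemidef_udisjRightMat (b : Cube n) : (udisjRightMat b).PosSemidef := by
  unfold udisjRightMat
  simpa using Matrix.posSemidef_vecMulVec_self_star (udisjRightVec b)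

/-- `⟨T_a, Y⟩ ≥ 0` for `Y ⪰ 0`. [cite: BraunEtAl2012, §4.3 proof of Lemma 9 (p. 14)] -/
theorem trace_udisjLeftMat_mul_nonneg (a : Cube n) {Y : Matrix (Fin (n + 1)) (Fin (n + 1)) ℝ}
    (hY : Y.PosSemidef) : 0 ≤ (udisjLeftMat a * Y).trace := by
  unfold udisjLeftMat
  rw [trace_vecMulVec_self_mul]
  simpa using hY.dotProduct_mulVec_nonneg (udisjLeftVec a)

/-! ### Lemma 9: the spectrahedron -/

/-- **BFPS's spectrahedron** `S ⊆ ℝ^{n×n}`, given by the semidefinite EF (4.3) of size `n + 1`: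
`S = {x ∣ ∃ Y ∈ S^{n+1}_+ : ⟨2diag(a) − aaᵀ, x⟩ + ⟨T_a, Y⟩ = 1 for all a ∈ {0,1}ⁿ}`.
[cite: BraunEtAl2012, §4.3 Lemma 9, eq. (4.3) (p. 14)] -/
def bfpsSpectrahedron (n : ℕ) : Set (Fin (n * n) → ℝ) :=
  {x | ∃ Y : Matrix (Fin (n + 1)) (Fin (n + 1)) ℝ, Y.PosSemidef ∧
    ∀ a : Cube n, flat (corCliqueMat a) ⬝ᵥ x + (udisjLeftMat a * Y).trace = 1}

/-- `S` is convex. [cite: BraunEtAl2012, §4.3 (p. 14, "a convex set admits a semidefinite EF iff it is a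
spectrahedron")] -/
theorem convex_bfpsSpectrahedron (n : ℕ) : Convex ℝ (bfpsSpectrahedron n) := by
  intro x hx y hy s t hs ht hst
  obtain ⟨Y₁, hY₁, h₁⟩ := hx
  obtain ⟨Y₂, hY₂, h₂⟩ := hy
  refine ⟨s • Y₁ + t • Y₂, (hY₁.smul hs).add (hY₂.smul ht), fun a => ?_⟩
  rw [dotProduct_add, dotProduct_smul, dotProduct_smul, Matrix.mul_add, Matrix.mul_smul, Matrix.mul_smul,
    Matrix.trace_add, Matrix.trace_smul, Matrix.trace_smul, smul_eq_mul, smul_eq_mul, smul_eq_mul, smul_eq_mul]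
  have e1 := h₁ a
  have e2 := h₂ a
  calc s * (flat (corCliqueMat a) ⬝ᵥ x) + t * (flat (corCliqueMat a) ⬝ᵥ y) +
        (s * (udisjLeftMat a * Y₁).trace + t * (udisjLeftMat a * Y₂).trace)
      = s * (flat (corCliqueMat a) ⬝ᵥ x + (udisjLeftMat a * Y₁).trace) +
          t * (flat (corCliqueMat a) ⬝ᵥ y + (udisjLeftMat a * Y₂).trace) := by ring
    _ = 1 := by rw [e1, e2, mul_one, mul_one, hst]

/-- **Lemma 9, «`P ⊆ S`»**: at a vertex `bbᵀ` take `Y = U^b` (`⟨2diag(a) − aaᵀ, bbᵀ⟩ + ⟨T_a, U^b⟩ =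
(1 − (1 − aᵀb)²) + (1 − aᵀb)² = 1`). [cite: BraunEtAl2012, §4.3 Lemma 9, proof (p. 14)] -/
theorem corPolytope_subset_bfpsSpectrahedron (n : ℕ) : corPolytope n ⊆ bfpsSpectrahedron n := by
  refine convexHull_min ?_ (convex_bfpsSpectrahedron n)
  rintro _ ⟨b, rfl⟩
  refine ⟨udisjRightMat b, posSemidef_udisjRightMat b, fun a => ?_⟩
  rw [trace_udisjLeftMat_mul_udisjRightMat, ← one_sub_flat_corCliqueMat_dotProduct_vecOuter]
  ring

/-- **Lemma 9, «`S ⊆ Q`»** (`⟨T_a, Y⟩ ≥ 0`). [cite: BraunEtAl2012, §4.3 Lemma 9, proof (p. 14)] -/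
theorem bfpsSpectrahedron_subset_corOuter (n : ℕ) : bfpsSpectrahedron n ⊆ corOuter n 1 := by
  rintro x ⟨Y, hY, h⟩ a
  have := trace_udisjLeftMat_mul_nonneg a hY
  linarith [h a]

/-! ### Theorem 10 -/

/-- The closed `δ`-neighbourhood of `S` in the entrywise `ℓ₁`-norm: `S^δ = {x ∣ ∃ x₀ ∈ S, ‖x − x₀‖₁ ≤ δ}`.
[cite: BraunEtAl2012, §4.3 (p. 14, definition of `S^ε`)] -/
def l1Nbhd {ι : Type*} [Fintype ι] (S : Set (ι → ℝ)) (δ : ℝ) : Set (ι → ℝ) :=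
  {x | ∃ x₀ ∈ S, ∑ p, |x p - x₀ p| ≤ δ}

/-- `S ⊆ S^δ` for `δ ≥ 0`. [cite: BraunEtAl2012, §4.3 (p. 14)] -/
theorem subset_l1Nbhd {ι : Type*} [Fintype ι] (S : Set (ι → ℝ)) {δ : ℝ} (hδ : 0 ≤ δ) : S ⊆ l1Nbhd S δ :=
  fun x hx => ⟨x, hx, by simpa using hδ⟩

/-- `‖2diag(a) − aaᵀ‖_∞ ≤ 1`: the entries of BFPS's clique matrix lie in `{−1, 0, 1}`.
[cite: BraunEtAl2012, §4.3 proof of Thm 10 (p. 15, "`‖2diag(a) − aaᵀ‖_∞ ≤ 1`")] -/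
theorem abs_flat_corCliqueMat_le_one (a : Cube n) (p : Fin (n * n)) : |flat (corCliqueMat a) p| ≤ 1 := by
  unfold flat corCliqueMat
  simp only [Matrix.sub_apply, Matrix.smul_apply, Matrix.diagonal_apply, Matrix.vecMulVec_apply, smul_eq_mul]
  set i := (finProdFinEquiv.symm p).1
  set j := (finProdFinEquiv.symm p).2
  rcases FixedSizePsdRank.bvec_zero_or_one a i with hi | hi <;>
    rcases FixedSizePsdRank.bvec_zero_or_one a j with hj | hj <;>
    by_cases hij : i = j <;> simp [hi, hj, hij] <;> norm_num

/-- Hölder: `|⟨c, v⟩| ≤ ‖c‖_∞ ‖v‖₁`, in the form `⟨c, v⟩ ≤ Σ |v_p|` when `|c_p| ≤ 1`.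
[cite: BraunEtAl2012, §4.3 proof of Thm 10 (p. 15)] -/
theorem dotProduct_le_sum_abs {ι : Type*} [Fintype ι] {c : ι → ℝ} (hc : ∀ p, |c p| ≤ 1) (v : ι → ℝ) :
    c ⬝ᵥ v ≤ ∑ p, |v p| := by
  unfold dotProduct
  refine Finset.sum_le_sum fun p _ => ?_
  have h1 : c p * v p ≤ |c p * v p| := le_abs_self _
  rw [abs_mul] at h1
  exact h1.trans (mul_le_of_le_one_left (abs_nonneg _) (hc p))

/-- **«`S^{ρ−1} ⊆ ρQ`»** (`ρ ≥ 1`): `⟨2diag(a) − aaᵀ, x⟩ ≤ ‖2diag(a) − aaᵀ‖_∞ ‖x − x₀‖₁ + 1 ≤ ρ`.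
[cite: BraunEtAl2012, §4.3 proof of Thm 10 (p. 15)] -/
theorem l1Nbhd_bfpsSpectrahedron_subset {ρ : ℝ} (n : ℕ) :
    l1Nbhd (bfpsSpectrahedron n) (ρ - 1) ⊆ corOuter n ρ := by
  rintro x ⟨x₀, hx₀, hdist⟩ a
  have h0 : flat (corCliqueMat a) ⬝ᵥ x₀ ≤ 1 := bfpsSpectrahedron_subset_corOuter n hx₀ a
  have h1 : flat (corCliqueMat a) ⬝ᵥ (x - x₀) ≤ ∑ p, |x p - x₀ p| :=
    dotProduct_le_sum_abs (abs_flat_corCliqueMat_le_one a) (x - x₀)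
  have h2 : flat (corCliqueMat a) ⬝ᵥ x = flat (corCliqueMat a) ⬝ᵥ (x - x₀) + flat (corCliqueMat a) ⬝ᵥ x₀ := by
    rw [← dotProduct_add, sub_add_cancel]
  rw [h2]
  linarith

/-- ★ **BFPS Theorem 10 (polyhedral inapproximability of SDPs), second bullet** — with the spectrahedron
`S = bfpsSpectrahedron n` of Lemma 9 (semidefinite EF of size `n + 1`, `COR(n) ⊆ S ⊆ Q(n)`): for
`0 ≤ β < 1/2` and `C > 0` there are `c > 0`, `n₀` such that for `n ≥ n₀`, `1 ≤ ρ ≤ C n^β`, every `K` with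
`S ⊆ K ⊆ S^{ρ−1}` and every size-`r` extended formulation of `K` satisfy `2^{c n^{1−2β}} ≤ r`
(«`xc(K) = 2^{Ω(n^{1−2β})}`»).  From Theorem 6: `COR(n) ⊆ S ⊆ K ⊆ S^{ρ−1} ⊆ ρQ(n)`.
[cite: BraunEtAl2012, Thm 10 (§4.3, pp. 14–15)] -/
theorem BFPS2012_thm10 (β : ℝ) (hβ0 : 0 ≤ β) (hβ : β < 1 / 2) (C : ℝ) (hC : 0 < C) :
    ∃ c : ℝ, 0 < c ∧ ∃ n₀ : ℕ, ∀ n : ℕ, n₀ ≤ n → ∀ ρ : ℝ, 1 ≤ ρ → ρ ≤ C * (n : ℝ) ^ β →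
      ∀ (K : Set (Fin (n * n) → ℝ)) (r : ℕ),
        bfpsSpectrahedron n ⊆ K → K ⊆ l1Nbhd (bfpsSpectrahedron n) (ρ - 1) → HasEFOfSize K r →
        (2 : ℝ) ^ (c * (n : ℝ) ^ (1 - 2 * β)) ≤ r := by
  obtain ⟨c, hc, n₀, hn₀⟩ := BFPS2012_corSandwichHard_holds β hβ0 hβ C hC
  refine ⟨c, hc, n₀, fun n hn ρ hρ1 hρC K r hSK hKS hEF => ?_⟩
  exact hn₀ n hn ρ hρ1 hρC K r ((corPolytope_subset_bfpsSpectrahedron n).trans hSK)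
    (hKS.trans (l1Nbhd_bfpsSpectrahedron_subset n)) hEF

/-- **BFPS Theorem 10, first bullet** («if `ρ` is a fixed constant, then `xc(K) = 2^{Ω(n)}`»): the case
`β = 0`, `C = ρ`. [cite: BraunEtAl2012, Thm 10 (§4.3, p. 15)] -/
theorem BFPS2012_thm10_fixedRatio (ρ : ℝ) (hρ : 1 ≤ ρ) :
    ∃ c : ℝ, 0 < c ∧ ∃ n₀ : ℕ, ∀ n : ℕ, n₀ ≤ n → ∀ (K : Set (Fin (n * n) → ℝ)) (r : ℕ),
      bfpsSpectrahedron n ⊆ K → K ⊆ l1Nbhd (bfpsSpectrahedron n) (ρ - 1) → HasEFOfSize K r →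
      (2 : ℝ) ^ (c * (n : ℝ)) ≤ r := by
  obtain ⟨c, hc, n₀, hn₀⟩ := BFPS2012_thm10 0 le_rfl (by norm_num) ρ (lt_of_lt_of_le one_pos hρ)
  refine ⟨c, hc, n₀, fun n hn K r hSK hKS hEF => ?_⟩
  have := hn₀ n hn ρ hρ (by simp) K r hSK hKS hEF
  simpa using this

end Literature.Combinatorics.Optimization

end
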